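import Literature.NumberTheory.LFunctions.Zhang2022.DetectorShiftPinnedModes
import Literature.NumberTheory.LFunctions.Zhang2022.DetectorDictShiftC0Zero

/-!
# Pinned lattice modes at the census FAIL points: kernel instances of `¬ Det.FormDetPSD (Det.shiftRecipe b)` off the box

Y. Zhang, *Discrete mean estimates and the Landau–Siegel zero*, arXiv:2211.02515v1 [Zhang2022LandauSiegel] — an
unrefereed manuscript under adjudication. Sub-cell E of the `landau-siegel` programme (ls-barrier-p6 g5, row S-E-p6-8;
unit tests named by ls-theory g3 / ls-barrier-plan g2 = the two-lineage NEG-certified points of the slot-region census,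
ls-barrier-p5 g5 kit j270198 / ls-num-2 g6 kit j270586). **WHAT THIS IS NOT: not a claim about Theorems 1–2 of
arXiv:2211.02515, about Landau–Siegel zeros, about a repaired `Margin232`, or about Parity.**

Each instance is `Det.not_formDetPSD_of_pin_excess` / `Det.not_formDetPSD_of_two_modes` (`DetectorShiftPinnedModes`) with
the lattice data checked by `norm_num` on rationals, plus a kernel sign `c₀(b) > 0` from the closed form
`Det.re_sum_shiftW_eq_c0Closed` (`c₀ = 2Φ_{1/2}(b)/D⁺(b)`) by exact trigonometry:
* the RAY `b = (1/2, 5/2, x)`, `5/2 < x < 9/2`: `Φ_{1/2} = 2x·sin(π/4)·sin(π(x − 5/2)/2) > 0` (`Det.re_sum_shiftW_ray_pos`) —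
  covers P1/P2/P3 and every ray point of the census;
* P2 `(1/2, 5/2, 18/5)` (`m₀ = −3`, `t = {−4, −2, −1}`), ray point `(1/2, 5/2, 15/4)` (`t = {−4, −2}`),
  P2b `(1/2, 11/5, 33/10)` (`t = {−2}`; `c₀ > 0` by `cos(π/20) > cos(π/4)`), `(13/10, 11/5, 29/10)` (`m₀ = −1`, `t = {−2}`;
  `c₀ > 0` by signs), and the `N = 2` point `(3/2, 5/2, 7/2)` (modes `−1, −3`; `c₀ > 0` = `Det.re_atomA0_threeHalves_pos`).

0 named facts, 0 sorries; standard axioms. Nothing here asserts anything about `L`-functions.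
«The programme SEARCHES and TYPES; no claim about Landau–Siegel zeros, Theorems 1–2 of arXiv:2211.02515 or a repaired
Margin232 until a kernel theorem says so.»
[cite: Zhang2022LandauSiegel, §2 Lemma 2.3; Prop 7.1 p.44 with (7.2), (7.19)–(7.21), (8.11)–(8.23); §18 (18.1)]
-/

noncomputable section

open Complex Real Set

namespace Literature.NumberTheory.LFunctions.Zhang2022

namespace Det

open Repair

/-! ### Part 1 — kernel signs `c₀(b) > 0` off the box -/

/-- A sorted triple is injective. [cite: Zhang2022LandauSiegel, §2 Lemma 2.3] -/
theorem injective_of_sorted {b : Fin 3 → ℝ} (h01 : b 0 < b 1) (h12 : b 1 < b 2) : Function.Injective b := by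
  intro i j hij
  fin_cases i <;> fin_cases j
  all_goals first | rfl | (exfalso; simp at hij; linarith)

/-- **`c₀ > 0` on the ray `b = (1/2, 5/2, x)`, `5/2 < x < 9/2`** (beyond the box edge `x = 3` as far as `9/2`):
`Φ_{1/2}(b) = 2x·sin(π/4)·sin(π(x − 5/2)/2)` because `sin(5π/4) = −sin(π/4)` and `sin(π(x − 1/2)/2) = −sin(π(x − 5/2)/2)`.
[cite: Zhang2022LandauSiegel, proof of Prop 7.1 (7.19)–(7.21)] -/
theorem re_sum_shiftW_ray_pos {x : ℝ} (hlo : 5 / 2 < x) (hhi : x < 9 / 2) :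
    0 < (∑ j : Fin 3, shiftW ![1 / 2, 5 / 2, x] j).re := by
  have h01 : (![1 / 2, 5 / 2, x] : Fin 3 → ℝ) 0 ≠ (![1 / 2, 5 / 2, x] : Fin 3 → ℝ) 1 := by
    change (1 / 2 : ℝ) ≠ 5 / 2; norm_num
  have h02 : (![1 / 2, 5 / 2, x] : Fin 3 → ℝ) 0 ≠ (![1 / 2, 5 / 2, x] : Fin 3 → ℝ) 2 := by
    change (1 / 2 : ℝ) ≠ x; exact ne_of_lt (by linarith)
  have h12 : (![1 / 2, 5 / 2, x] : Fin 3 → ℝ) 1 ≠ (![1 / 2, 5 / 2, x] : Fin 3 → ℝ) 2 := by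
    change (5 / 2 : ℝ) ≠ x; exact ne_of_lt hlo
  rw [re_sum_shiftW_eq_c0Closed _ h01 h02 h12]
  unfold c0Closed phiTheta dPlus
  simp only [Matrix.cons_val_zero, Matrix.cons_val_one, Matrix.head_cons, Matrix.cons_val_two, Matrix.tail_cons]
  have e0 : Real.sin (1 / 2 * π * (1 / 2)) = Real.sin (π / 4) := by congr 1; ring
  have e1 : Real.sin (1 / 2 * π * (5 / 2)) = -Real.sin (π / 4) := by
    rw [show 1 / 2 * π * (5 / 2 : ℝ) = π / 4 + π by ring, Real.sin_add_pi]
  have e2 : Real.sin (1 / 2 * π * (x - 1 / 2)) = -Real.sin (1 / 2 * π * (x - 5 / 2)) := by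
    rw [show 1 / 2 * π * (x - 1 / 2) = 1 / 2 * π * (x - 5 / 2) + π by ring, Real.sin_add_pi]
  rw [e0, e1, e2]
  have hs4 : 0 < Real.sin (π / 4) := by rw [Real.sin_pi_div_four]; positivity
  have hu : 0 < Real.sin (1 / 2 * π * (x - 5 / 2)) :=
    Real.sin_pos_of_pos_of_lt_pi (by nlinarith [Real.pi_pos]) (by nlinarith [Real.pi_pos])
  have hx : 0 < x := by linarith
  have hD : 0 < (5 / 2 - 1 / 2) * (x - 1 / 2) * (x - 5 / 2) := by
    have h1 : 0 < x - 1 / 2 := by linarith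
    have h2 : 0 < x - 5 / 2 := by linarith
    positivity
  rw [show 2 * (5 / 2 * (x - 1 / 2) * Real.sin (π / 4) * Real.sin (1 / 2 * π * (x - 5 / 2))
      - 1 / 2 * (x - 5 / 2) * -Real.sin (π / 4) * -Real.sin (1 / 2 * π * (x - 5 / 2)))
      = 4 * x * (Real.sin (π / 4) * Real.sin (1 / 2 * π * (x - 5 / 2))) by ring]
  exact div_pos (mul_pos (mul_pos (by norm_num) hx) (mul_pos hs4 hu)) hD

/-- **`c₀(13/10, 11/5, 29/10) > 0`** by signs alone: `Φ_{1/2} = (11/5)(8/5)·sin(13π/20)·sin(7π/20) + (13/10)(7/10)·sin(π/10)·sin(4π/5)`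
(`sin(11π/10) = −sin(π/10)`). [cite: Zhang2022LandauSiegel, proof of Prop 7.1 (7.19)–(7.21)] -/
theorem re_sum_shiftW_pos_thirteenTenths : 0 < (∑ j : Fin 3, shiftW ![13 / 10, 11 / 5, 29 / 10] j).re := by
  rw [re_sum_shiftW_eq_c0Closed _ (by norm_num) (by norm_num [Matrix.cons_val_two, Matrix.tail_cons])
    (by norm_num [Matrix.cons_val_two, Matrix.tail_cons])]
  unfold c0Closed phiTheta dPlus
  simp only [Matrix.cons_val_zero, Matrix.cons_val_one, Matrix.head_cons, Matrix.cons_val_two, Matrix.tail_cons]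
  have e1 : Real.sin (1 / 2 * π * (11 / 5)) = -Real.sin (π / 10) := by
    rw [show 1 / 2 * π * (11 / 5 : ℝ) = π / 10 + π by ring, Real.sin_add_pi]
  rw [e1]
  have h1 : 0 < Real.sin (1 / 2 * π * (13 / 10)) :=
    Real.sin_pos_of_pos_of_lt_pi (by positivity) (by nlinarith [Real.pi_pos])
  have h2 : 0 < Real.sin (1 / 2 * π * (29 / 10 - 11 / 5)) :=
    Real.sin_pos_of_pos_of_lt_pi (by norm_num; positivity) (by nlinarith [Real.pi_pos])
  have h3 : 0 < Real.sin (π / 10) := Real.sin_pos_of_pos_of_lt_pi (by positivity) (by linarith [Real.pi_pos])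
  have h4 : 0 < Real.sin (1 / 2 * π * (29 / 10 - 13 / 10)) :=
    Real.sin_pos_of_pos_of_lt_pi (by norm_num; positivity) (by nlinarith [Real.pi_pos])
  apply div_pos _ (by norm_num)
  nlinarith [mul_pos h1 h2, mul_pos h3 h4]

/-- **`c₀(1/2, 11/5, 33/10) > 0`** (P2b): `Φ_{1/2} = (154/25)·sin(π/4)·cos(π/20) − (11/20)·sin(π/10)·sin(2π/5)`, and
`cos(π/20) > cos(π/4) = sin(π/4) = √2/2` makes the first term `> 77/25 > 11/20`.
[cite: Zhang2022LandauSiegel, proof of Prop 7.1 (7.19)–(7.21)] -/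
theorem re_sum_shiftW_pos_P2b : 0 < (∑ j : Fin 3, shiftW ![1 / 2, 11 / 5, 33 / 10] j).re := by
  rw [re_sum_shiftW_eq_c0Closed _ (by norm_num) (by norm_num [Matrix.cons_val_two, Matrix.tail_cons])
    (by norm_num [Matrix.cons_val_two, Matrix.tail_cons])]
  unfold c0Closed phiTheta dPlus
  simp only [Matrix.cons_val_zero, Matrix.cons_val_one, Matrix.head_cons, Matrix.cons_val_two, Matrix.tail_cons]
  have e0 : Real.sin (1 / 2 * π * (1 / 2)) = √2 / 2 := by
    rw [show 1 / 2 * π * (1 / 2 : ℝ) = π / 4 by ring, Real.sin_pi_div_four]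
  have e1 : Real.sin (1 / 2 * π * (33 / 10 - 11 / 5)) = Real.cos (π / 20) := by
    rw [show 1 / 2 * π * (33 / 10 - 11 / 5 : ℝ) = π / 20 + π / 2 by ring, Real.sin_add_pi_div_two]
  have e2 : Real.sin (1 / 2 * π * (11 / 5)) = -Real.sin (π / 10) := by
    rw [show 1 / 2 * π * (11 / 5 : ℝ) = π / 10 + π by ring, Real.sin_add_pi]
  have e3 : Real.sin (1 / 2 * π * (33 / 10 - 1 / 2)) = -Real.sin (2 * π / 5) := by
    rw [show 1 / 2 * π * (33 / 10 - 1 / 2 : ℝ) = 2 * π / 5 + π by ring, Real.sin_add_pi]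
  rw [e0, e1, e2, e3]
  have hc : √2 / 2 < Real.cos (π / 20) := by
    rw [← Real.cos_pi_div_four]
    exact Real.cos_lt_cos_of_nonneg_of_le_pi (by positivity) (by linarith [Real.pi_pos])
      (by linarith [Real.pi_pos])
  have hsq : √2 / 2 * (√2 / 2) = 1 / 2 := by
    rw [div_mul_div_comm, Real.mul_self_sqrt (by norm_num : (0:ℝ) ≤ 2)]; norm_num
  have hs2 : 0 < √2 / 2 := by positivity
  have h3 : 0 ≤ Real.sin (π / 10) := (Real.sin_pos_of_pos_of_lt_pi (by positivity) (by linarith [Real.pi_pos])).le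
  have h4 : 0 ≤ Real.sin (2 * π / 5) := (Real.sin_pos_of_pos_of_lt_pi (by positivity) (by linarith [Real.pi_pos])).le
  have h3' : Real.sin (π / 10) ≤ 1 := Real.sin_le_one _
  have h4' : Real.sin (2 * π / 5) ≤ 1 := Real.sin_le_one _
  have hprod : Real.sin (π / 10) * Real.sin (2 * π / 5) ≤ 1 := by nlinarith
  have hfirst : 1 / 2 < √2 / 2 * Real.cos (π / 20) := by nlinarith [mul_lt_mul_of_pos_left hc hs2]
  apply div_pos _ (by norm_num)
  nlinarith [mul_nonneg h3 h4]

/-! ### Part 2 — the census FAIL points as kernel theorems -/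

/-- Lattice data of `b = (1/2, 5/2, 18/5)` (P2): `σ(−3) = −9/4`, `σ(−4) = 42/5`, `σ(−2) = 12/5`, `σ(−1) = 39/20`.
[cite: Zhang2022LandauSiegel, §2 Lemma 2.3; Prop 7.1 (8.11)–(8.23)] -/
theorem latticeSymbol_P2 :
    latticeSymbol ![1 / 2, 5 / 2, 18 / 5] (-3) = -9 / 4 ∧ latticeSymbol ![1 / 2, 5 / 2, 18 / 5] (-4) = 42 / 5 ∧
      latticeSymbol ![1 / 2, 5 / 2, 18 / 5] (-2) = 12 / 5 ∧ latticeSymbol ![1 / 2, 5 / 2, 18 / 5] (-1) = 39 / 20 := by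
  refine ⟨?_, ?_, ?_, ?_⟩ <;>
    norm_num [latticeSymbol, Matrix.cons_val_zero, Matrix.cons_val_one, Matrix.head_cons, Matrix.cons_val_two,
      Matrix.tail_cons]

/-- **P2: `¬ FormDetPSD (shiftRecipe (1/2, 5/2, 18/5))`** — one negative mode `m₀ = −3` (`N = 1`), pin-index excess already on
`t = {−4, −2, −1}`: `(9/4)·(40/21 + 5/3 + 20/39) = (9/4)(1115/273) > 9` (census: S(b) = +1.078 > 0, both slots NEG-certified,
kits j270198 / j270586). [cite: Zhang2022LandauSiegel, §2 Lemma 2.3; Prop 7.1 p.44 with (7.2), (8.11)–(8.23)] -/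
theorem not_formDetPSD_P2 : ¬ FormDetPSD (shiftRecipe ![1 / 2, 5 / 2, 18 / 5]) := by
  obtain ⟨h3, h4, h2, h1⟩ := latticeSymbol_P2
  refine not_formDetPSD_of_pin_excess (injective_of_sorted (by norm_num)
      (by norm_num [Matrix.cons_val_two, Matrix.tail_cons])) (re_sum_shiftW_ray_pos (by norm_num) (by norm_num))
    (m₀ := -3) (by rw [h3]; norm_num) {-4, -2, -1} ?_ ?_
  · intro m hm
    simp only [Finset.mem_insert, Finset.mem_singleton] at hm
    rcases hm with rfl | rfl | rfl
    · rw [h4]; norm_num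
    · rw [h2]; norm_num
    · rw [h1]; norm_num
  · rw [Finset.sum_insert (by decide), Finset.sum_insert (by decide), Finset.sum_singleton, h3, h4, h2, h1,
      abs_of_neg (by norm_num)]
    norm_num

/-- P2, glued slot: `¬ GluedFormPSD (1/2, 5/2, 18/5)`. [cite: Zhang2022LandauSiegel, Prop 7.1 p.44 with (7.2); §18 (18.1)] -/
theorem not_gluedFormPSD_P2 : ¬ GluedFormPSD ![1 / 2, 5 / 2, 18 / 5] :=
  not_gluedFormPSD_of_not_formDetPSD not_formDetPSD_P2

/-- Lattice data of the ray point `b = (1/2, 5/2, 15/4)`: `σ(−3) = −45/16`, `σ(−4) = 21/4`, `σ(−2) = 21/8`.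
[cite: Zhang2022LandauSiegel, §2 Lemma 2.3; Prop 7.1 (8.11)–(8.23)] -/
theorem latticeSymbol_ray_fifteenFourths :
    latticeSymbol ![1 / 2, 5 / 2, 15 / 4] (-3) = -45 / 16 ∧ latticeSymbol ![1 / 2, 5 / 2, 15 / 4] (-4) = 21 / 4 ∧
      latticeSymbol ![1 / 2, 5 / 2, 15 / 4] (-2) = 21 / 8 := by
  refine ⟨?_, ?_, ?_⟩ <;>
    norm_num [latticeSymbol, Matrix.cons_val_zero, Matrix.cons_val_one, Matrix.head_cons, Matrix.cons_val_two,
      Matrix.tail_cons]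

/-- **Ray point `(1/2, 5/2, 15/4)` (`≥ 71/20`, beyond the boundary `7/2`): `¬ FormDetPSD`** — `m₀ = −3`, `t = {−4, −2}`:
`(45/16)·(64/21 + 32/21) = 90/7 > 9`. [cite: Zhang2022LandauSiegel, §2 Lemma 2.3; Prop 7.1 p.44 with (7.2), (8.11)–(8.23)] -/
theorem not_formDetPSD_ray_fifteenFourths : ¬ FormDetPSD (shiftRecipe ![1 / 2, 5 / 2, 15 / 4]) := by
  obtain ⟨h3, h4, h2⟩ := latticeSymbol_ray_fifteenFourths
  refine not_formDetPSD_of_pin_excess (injective_of_sorted (by norm_num)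
      (by norm_num [Matrix.cons_val_two, Matrix.tail_cons])) (re_sum_shiftW_ray_pos (by norm_num) (by norm_num))
    (m₀ := -3) (by rw [h3]; norm_num) {-4, -2} ?_ ?_
  · intro m hm
    simp only [Finset.mem_insert, Finset.mem_singleton] at hm
    rcases hm with rfl | rfl
    · rw [h4]; norm_num
    · rw [h2]; norm_num
  · rw [Finset.sum_insert (by decide), Finset.sum_singleton, h3, h4, h2, abs_of_neg (by norm_num)]
    norm_num

/-- Ray point, glued slot: `¬ GluedFormPSD (1/2, 5/2, 15/4)`. [cite: Zhang2022LandauSiegel, Prop 7.1 p.44 with (7.2); §18 (18.1)] -/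
theorem not_gluedFormPSD_ray_fifteenFourths : ¬ GluedFormPSD ![1 / 2, 5 / 2, 15 / 4] :=
  not_gluedFormPSD_of_not_formDetPSD not_formDetPSD_ray_fifteenFourths

/-- Lattice data of `b = (1/2, 11/5, 33/10)` (P2b): `σ(−3) = −9/5`, `σ(−2) = 39/50`.
[cite: Zhang2022LandauSiegel, §2 Lemma 2.3; Prop 7.1 (8.11)–(8.23)] -/
theorem latticeSymbol_P2b :
    latticeSymbol ![1 / 2, 11 / 5, 33 / 10] (-3) = -9 / 5 ∧ latticeSymbol ![1 / 2, 11 / 5, 33 / 10] (-2) = 39 / 50 := by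
  refine ⟨?_, ?_⟩ <;>
    norm_num [latticeSymbol, Matrix.cons_val_zero, Matrix.cons_val_one, Matrix.head_cons, Matrix.cons_val_two,
      Matrix.tail_cons]

/-- **P2b: `¬ FormDetPSD (shiftRecipe (1/2, 11/5, 33/10))`** — `m₀ = −3`, `t = {−2}`: `(9/5)·(200/39) = 120/13 > 9` (census
S(b) = +2.64; NEG-certified 3/3). [cite: Zhang2022LandauSiegel, §2 Lemma 2.3; Prop 7.1 p.44 with (7.2), (8.11)–(8.23)] -/
theorem not_formDetPSD_P2b : ¬ FormDetPSD (shiftRecipe ![1 / 2, 11 / 5, 33 / 10]) := by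
  obtain ⟨h3, h2⟩ := latticeSymbol_P2b
  refine not_formDetPSD_of_pin_excess (injective_of_sorted (by norm_num)
      (by norm_num [Matrix.cons_val_two, Matrix.tail_cons])) re_sum_shiftW_pos_P2b
    (m₀ := -3) (by rw [h3]; norm_num) {-2} ?_ ?_
  · intro m hm
    rw [Finset.mem_singleton] at hm
    subst hm
    rw [h2]; norm_num
  · rw [Finset.sum_singleton, h3, h2, abs_of_neg (by norm_num)]
    norm_num

/-- P2b, glued slot: `¬ GluedFormPSD (1/2, 11/5, 33/10)`. [cite: Zhang2022LandauSiegel, Prop 7.1 p.44 with (7.2); §18 (18.1)] -/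
theorem not_gluedFormPSD_P2b : ¬ GluedFormPSD ![1 / 2, 11 / 5, 33 / 10] :=
  not_gluedFormPSD_of_not_formDetPSD not_formDetPSD_P2b

/-- Lattice data of `b = (13/10, 11/5, 29/10)`: `σ(−1) = −171/250` (the violated gap is `b₀ > 1`), `σ(−2) = 63/250`.
[cite: Zhang2022LandauSiegel, §2 Lemma 2.3; Prop 7.1 (8.11)–(8.23)] -/
theorem latticeSymbol_thirteenTenths :
    latticeSymbol ![13 / 10, 11 / 5, 29 / 10] (-1) = -171 / 250 ∧
      latticeSymbol ![13 / 10, 11 / 5, 29 / 10] (-2) = 63 / 250 := by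
  refine ⟨?_, ?_⟩ <;>
    norm_num [latticeSymbol, Matrix.cons_val_zero, Matrix.cons_val_one, Matrix.head_cons, Matrix.cons_val_two,
      Matrix.tail_cons]

/-- **`¬ FormDetPSD (shiftRecipe (13/10, 11/5, 29/10))`** (first gap violated, `b₀ > 1`) — `m₀ = −1`, `t = {−2}`:
`(171/250)·(4·250/63) = 76/7 > 1` (census S(b) = +38.07; NEG-certified). [cite: Zhang2022LandauSiegel, §2 Lemma 2.3; Prop 7.1 p.44 with (7.2), (8.11)–(8.23)] -/
theorem not_formDetPSD_thirteenTenths : ¬ FormDetPSD (shiftRecipe ![13 / 10, 11 / 5, 29 / 10]) := by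
  obtain ⟨h1, h2⟩ := latticeSymbol_thirteenTenths
  refine not_formDetPSD_of_pin_excess (injective_of_sorted (by norm_num)
      (by norm_num [Matrix.cons_val_two, Matrix.tail_cons])) re_sum_shiftW_pos_thirteenTenths
    (m₀ := -1) (by rw [h1]; norm_num) {-2} ?_ ?_
  · intro m hm
    rw [Finset.mem_singleton] at hm
    subst hm
    rw [h2]; norm_num
  · rw [Finset.sum_singleton, h1, h2, abs_of_neg (by norm_num)]
    norm_num

/-- Glued slot: `¬ GluedFormPSD (13/10, 11/5, 29/10)`. [cite: Zhang2022LandauSiegel, Prop 7.1 p.44 with (7.2); §18 (18.1)] -/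
theorem not_gluedFormPSD_thirteenTenths : ¬ GluedFormPSD ![13 / 10, 11 / 5, 29 / 10] :=
  not_gluedFormPSD_of_not_formDetPSD not_formDetPSD_thirteenTenths

/-- Lattice data of `b = (3/2, 5/2, 7/2)`: TWO negative modes `σ(−1) = −15/8`, `σ(−3) = −9/8` (`N = 2`).
[cite: Zhang2022LandauSiegel, §2 Lemma 2.3; Prop 7.1 (8.11)–(8.23)] -/
theorem latticeSymbol_threeHalves_neg :
    latticeSymbol ![3 / 2, 5 / 2, 7 / 2] (-1) = -15 / 8 ∧ latticeSymbol ![3 / 2, 5 / 2, 7 / 2] (-3) = -9 / 8 := by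
  refine ⟨?_, ?_⟩ <;>
    norm_num [latticeSymbol, Matrix.cons_val_zero, Matrix.cons_val_one, Matrix.head_cons, Matrix.cons_val_two,
      Matrix.tail_cons]

/-- **`N = 2`: `¬ FormDetPSD (shiftRecipe (3/2, 5/2, 7/2))`** — the ONE-SIDED slot already fails at num-2's third named
non-admissible point (stronger than the tree's `Det.not_dictShiftPSD_threeHalves`); `c₀ > 0` is `Det.re_atomA0_threeHalves_pos`.
[cite: Zhang2022LandauSiegel, §2 Lemma 2.3; Prop 7.1 p.44 with (7.2), (8.11)–(8.23)] -/
theorem not_formDetPSD_threeHalves : ¬ FormDetPSD (shiftRecipe ![3 / 2, 5 / 2, 7 / 2]) := by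
  obtain ⟨h1, h3⟩ := latticeSymbol_threeHalves_neg
  have hc : 0 < (∑ j : Fin 3, shiftW ![(3:ℝ) / 2, 5 / 2, 7 / 2] j).re := by
    have := re_atomA0_threeHalves_pos
    simp only [atomA0] at this
    exact this
  exact not_formDetPSD_of_two_modes (injective_of_sorted (by norm_num)
      (by norm_num [Matrix.cons_val_two, Matrix.tail_cons])) hc (m₁ := -1) (m₂ := -3)
    (by decide) (by decide) (by rw [h1]; norm_num) (by rw [h3]; norm_num)

/-- `N = 2`, glued slot: `¬ GluedFormPSD (3/2, 5/2, 7/2)`. [cite: Zhang2022LandauSiegel, Prop 7.1 p.44 with (7.2); §18 (18.1)] -/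
theorem not_gluedFormPSD_threeHalves : ¬ GluedFormPSD ![3 / 2, 5 / 2, 7 / 2] :=
  not_gluedFormPSD_of_not_formDetPSD not_formDetPSD_threeHalves

/-- **`c₀(1/8, 3/8, 13/8) > 0`**: `Φ_{1/2} = (9/16)·sin(π/16)·cos(π/8) − (5/32)·sin(3π/16)·sin(3π/4)`; with
`sin(3π/16) = 3sin(π/16) − 4sin³(π/16)`, `sin(3π/4) = √2/2` and `cos(π/8) > cos(π/4) = √2/2` the first term dominates.
[cite: Zhang2022LandauSiegel, proof of Prop 7.1 (7.19)–(7.21)] -/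
theorem re_sum_shiftW_pos_oneEighth : 0 < (∑ j : Fin 3, shiftW ![1 / 8, 3 / 8, 13 / 8] j).re := by
  rw [re_sum_shiftW_eq_c0Closed _ (by norm_num) (by norm_num [Matrix.cons_val_two, Matrix.tail_cons])
    (by norm_num [Matrix.cons_val_two, Matrix.tail_cons])]
  unfold c0Closed phiTheta dPlus
  simp only [Matrix.cons_val_zero, Matrix.cons_val_one, Matrix.head_cons, Matrix.cons_val_two, Matrix.tail_cons]
  have e0 : Real.sin (1 / 2 * π * (1 / 8)) = Real.sin (π / 16) := by congr 1; ring
  have e1 : Real.sin (1 / 2 * π * (13 / 8 - 3 / 8)) = Real.cos (π / 8) := by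
    rw [show 1 / 2 * π * (13 / 8 - 3 / 8 : ℝ) = π / 8 + π / 2 by ring, Real.sin_add_pi_div_two]
  have e2 : Real.sin (1 / 2 * π * (3 / 8)) = 3 * Real.sin (π / 16) - 4 * Real.sin (π / 16) ^ 3 := by
    rw [show 1 / 2 * π * (3 / 8 : ℝ) = 3 * (π / 16) by ring, Real.sin_three_mul]
  have e3 : Real.sin (1 / 2 * π * (13 / 8 - 1 / 8)) = √2 / 2 := by
    rw [show 1 / 2 * π * (13 / 8 - 1 / 8 : ℝ) = π - π / 4 by ring, Real.sin_pi_sub, Real.sin_pi_div_four]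
  rw [e0, e1, e2, e3]
  have hc : √2 / 2 < Real.cos (π / 8) := by
    rw [← Real.cos_pi_div_four]
    exact Real.cos_lt_cos_of_nonneg_of_le_pi (by positivity) (by linarith [Real.pi_pos])
      (by linarith [Real.pi_pos])
  have hs : 0 < Real.sin (π / 16) := Real.sin_pos_of_pos_of_lt_pi (by positivity) (by linarith [Real.pi_pos])
  have h2 : 0 < √2 := by positivity
  have hX : 0 < 9 / 16 * Real.cos (π / 8) - 15 / 32 * (√2 / 2) := by linarith
  apply div_pos _ (by norm_num)
  rw [show 2 * (3 / 8 * (13 / 8 - 1 / 8) * Real.sin (π / 16) * Real.cos (π / 8)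
      - 1 / 8 * (13 / 8 - 3 / 8) * (3 * Real.sin (π / 16) - 4 * Real.sin (π / 16) ^ 3) * (√2 / 2))
      = 2 * (Real.sin (π / 16) * (9 / 16 * Real.cos (π / 8) - 15 / 32 * (√2 / 2))
        + 5 / 8 * (√2 / 2) * Real.sin (π / 16) ^ 3) by ring]
  have h3 : 0 ≤ 5 / 8 * (√2 / 2) * Real.sin (π / 16) ^ 3 := by positivity
  nlinarith [mul_pos hs hX]

/-- Lattice data of `b = (1/8, 3/8, 13/8)`: the negative mode `σ(−1) = −175/512`.
[cite: Zhang2022LandauSiegel, §2 Lemma 2.3; Prop 7.1 (8.11)–(8.23)] -/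
theorem latticeSymbol_oneEighth_neg_one : latticeSymbol ![1 / 8, 3 / 8, 13 / 8] (-1) = -175 / 512 := by
  norm_num [latticeSymbol, Matrix.cons_val_zero, Matrix.cons_val_one, Matrix.head_cons, Matrix.cons_val_two,
    Matrix.tail_cons]

/-- **The THIN point `(1/8, 3/8, 13/8)`: `¬ FormDetPSD`** (census S(b) = +0.161, S/π = +0.051; NEG-certified −0.0025) —
`m₀ = −1`, and the 24 positive modes `−13 ≤ m ≤ 12` already carry the excess: `(175/512)·Σ m²/σ_b(m) > 1`.
[cite: Zhang2022LandauSiegel, §2 Lemma 2.3; Prop 7.1 p.44 with (7.2), (8.11)–(8.23)] -/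
theorem not_formDetPSD_oneEighth : ¬ FormDetPSD (shiftRecipe ![1 / 8, 3 / 8, 13 / 8]) := by
  refine not_formDetPSD_of_pin_excess (injective_of_sorted (by norm_num)
      (by norm_num [Matrix.cons_val_two, Matrix.tail_cons])) re_sum_shiftW_pos_oneEighth
    (m₀ := -1) (by rw [latticeSymbol_oneEighth_neg_one]; norm_num)
    {-13, -12, -11, -10, -9, -8, -7, -6, -5, -4, -3, -2, 1, 2, 3, 4, 5, 6, 7, 8, 9, 10, 11, 12} ?_ ?_
  · intro m hm
    fin_cases hm <;>
      norm_num [latticeSymbol, Matrix.cons_val_zero, Matrix.cons_val_one, Matrix.head_cons, Matrix.cons_val_two,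
        Matrix.tail_cons]
  · rw [latticeSymbol_oneEighth_neg_one, abs_of_neg (by norm_num)]
    repeat rw [Finset.sum_insert (by decide)]
    rw [Finset.sum_singleton]
    norm_num [latticeSymbol, Matrix.cons_val_zero, Matrix.cons_val_one, Matrix.head_cons, Matrix.cons_val_two,
      Matrix.tail_cons]

/-- Thin point, glued slot: `¬ GluedFormPSD (1/8, 3/8, 13/8)`. [cite: Zhang2022LandauSiegel, Prop 7.1 p.44 with (7.2); §18 (18.1)] -/
theorem not_gluedFormPSD_oneEighth : ¬ GluedFormPSD ![1 / 8, 3 / 8, 13 / 8] :=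
  not_gluedFormPSD_of_not_formDetPSD not_formDetPSD_oneEighth

end Det

end Literature.NumberTheory.LFunctions.Zhang2022
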